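import Summits.NavierStokesRegularity.NavierStokesRegularity.Theorems.ExtremiserTransienceTwoThirdsTypicality
import Summits.NavierStokesRegularity.NavierStokesRegularity.Theorems.ExtremiserTransienceTwoThirdsBallCalculus
import Summits.NavierStokesRegularity.NavierStokesRegularity.Theorems.ExtremiserTransienceLocalMaximiserThickGoodCentre
import HarnessLib

/-!
# Route `ExtremiserTransience`, crux `NearExtremalTransiencePerFlow` (stmt-NavierStokesRegularity-26567),
# LINE g10-1 «two_thirds» (ns-idea-10), stub S1a′ — BRICK 3b, lemma (ii): PER-PACKING CHEBYSHEV from the EXCESS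

`--supports stmt-NavierStokesRegularity-26567` (helper; prover seat ns-net-p2 g12; design = evidence #59 on ⟨26567⟩).  Normalised units (`lam w = 1`,
so `W = Z`).  ONE packing: a finite `2s`-disjoint family `F` of cells `B(c, s)` and the remainder `R = (⋃_{c∈F} B(c,s))ᶜ`.  The raw ball functionals
`Jb, Zb, Wb` (texts p719439) and the remainder functionals partition `J, Z, W` EXACTLY; the per-piece sharp inequality is made automatic by
capping `Jp := min(J_P, κ⋆√(Z_P W_P))`, at the price of the EXCESS `Σ_P (J_P − κ⋆√(Z_P W_P))₊ ≤ EX` in the near-equality.  Then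
`typicality_abstract` (p724236, ns-idea-10 g10) and the trivial count of heavy-layer cells give

* `sum_Zb_notGood_le` — `Σ_{c ∈ F, ¬IsGoodBall w c s δ} Z_{B(c,s)} ≤ (ε/κ⋆ + EX/(κ⋆Z))·(18/δ² + 2/δ)·Z + δ⁻¹·Σ_{c∈F} layer_c`,
  `layer_c = bulk(B(c, s+s^{7/8})) − bulk(B(c,s))` (`0 < δ ≤ 1/2`).

Brick 2 supplies `EX(τ)`; brick 3b(iii) integrates over the translates and feeds brick 4d (p726775).  HONEST FRAMING: finite bookkeeping over one
vector field; nothing about Navier–Stokes is proved; no summit is proved by a line. [folklore]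
-/

noncomputable section

open scoped Topology InnerProductSpace RealInnerProductSpace ENNReal NNReal ContDiff
open MeasureTheory Filter Set Metric Function
open Literature.Analysis Literature.Analysis.FluidPDE
open Summit.NavierStokesRegularity.NavierStokesRegularity.Theorems.DepletionLadder
open Summit.NavierStokesRegularity.NavierStokesRegularity.Theorems.DepletionLadder.KStar.HalfSpace
open Summit.NavierStokesRegularity.NavierStokesRegularity.Theorems.DepletionLadder.KStar.BangBang
open Summit.NavierStokesRegularity.NavierStokesRegularity.Theorems.NearExtremalTransiencePerFlow.LocalMaximiser

namespace Summit.NavierStokesRegularity.NavierStokesRegularity.Theorems.NearExtremalTransiencePerFlow.TwoThirds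

-- the problem directory repeats the summit name (`NavierStokesRegularity/NavierStokesRegularity`)
set_option linter.dupNamespace false
set_option linter.style.longLine false

/-- `min a b = a − (a − b)₊`. -/
theorem min_eq_sub_posPart (a b : ℝ) : min a b = a - max (a - b) 0 := by
  rcases le_total a b with h | h
  · rw [min_eq_left h, max_eq_right (by linarith), sub_zero]
  · rw [min_eq_right h, max_eq_left (by linarith)]; ring

/-- **Partition of an integral by a finite disjoint family of balls and its complement.** -/
theorem integral_eq_sum_balls_add_compl {f : E3 → ℝ} (hf : Integrable f) (F : Finset E3) {s : ℝ}
    (hsep : ∀ c ∈ F, ∀ c' ∈ F, c ≠ c' → 2 * s ≤ dist c c') :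
    ∫ x, f x = (∑ c ∈ F, ∫ x in Metric.ball c s, f x) + ∫ x in (⋃ c ∈ F, Metric.ball c s)ᶜ, f x := by
  have hdisj : Set.Pairwise (↑F : Set E3) (Disjoint on fun c => Metric.ball c s) := by
    intro c hc c' hc' hne
    exact Metric.ball_disjoint_ball (by linarith [hsep c hc c' hc' hne])
  have hUm : MeasurableSet (⋃ c ∈ F, Metric.ball c s) := Finset.measurableSet_biUnion _ fun c _ => measurableSet_ball
  rw [← integral_biUnion_finset F (fun c _ => measurableSet_ball) hdisj (fun c _ => hf.integrableOn), integral_add_compl hUm hf]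

open Classical in
/-- **Brick 3b (ii) — per-packing Chebyshev from the excess.**  See the module docstring. [folklore] -/
theorem sum_Zb_notGood_le {A : ℕ → ℝ} {w : E3 → E3} {B ε : ℝ} (hadm : IsAdm w 1 B) (hZ : 0 < Zen w) (hW : 0 < Wpa w)
    (hlam : lam w = 1) (hext : (kStar - ε) * Real.sqrt (Zen w) * Real.sqrt (Wpa w) ≤ Jst w)
    {s δ : ℝ} (hs : 0 < s) (hδ : 0 < δ) (hδ1 : δ ≤ 1 / 2) (F : Finset E3)
    (hsep : ∀ c ∈ F, ∀ c' ∈ F, c ≠ c' → 2 * s ≤ dist c c') {EX : ℝ}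
    (hEX : (∑ c ∈ F, max (Jb w c s - kStar * Real.sqrt (Zb w c s * Wb w c s)) 0) +
        max ((∫ x in (⋃ c ∈ F, Metric.ball c s)ᶜ, sd w x) -
          kStar * Real.sqrt ((∫ x in (⋃ c ∈ F, Metric.ball c s)ᶜ, zd w x) * (∫ x in (⋃ c ∈ F, Metric.ball c s)ᶜ, wd w x))) 0 ≤ EX) :
    ∑ c ∈ F.filter (fun c => ¬ IsGoodBall w c s δ), Zb w c s ≤
      (ε / kStar + EX / (kStar * Zen w)) * (18 / δ ^ 2 + 2 / δ) * Zen w +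
        δ⁻¹ * ∑ c ∈ F, ((Zb w c (s + s ^ (7 / 8 : ℝ)) + Wb w c (s + s ^ (7 / 8 : ℝ))) - (Zb w c s + Wb w c s)) := by
  classical
  have _hA := A
  obtain ⟨hv, hdiv, hvM, hvB, h0, h1, h2⟩ := id hadm
  have hv2 : ContDiff ℝ 2 w := hv.of_le (by norm_cast)
  have hv3 : ContDiff ℝ 3 w := hv.of_le (by norm_cast)
  have hκ : 0 < kStar := kStar_pos
  -- `W = Z` in normalised units
  have hWZ : Wpa w = Zen w := by
    have h : Real.sqrt (Zen w / Wpa w) = 1 := hlam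
    have h2' : Zen w / Wpa w = 1 := by
      have := Real.sqrt_eq_one.1 h
      exact this
    field_simp at h2'
    linarith
  -- integrability of the three densities
  have izd : Integrable (zd w) := (integrable_norm_curl_sq hv2 h1).1
  have iwd : Integrable (wd w) := (integrable_frobeniusNormSq_fderiv_curl hv3 h2).1
  have isd : Integrable (sd w) := KStar.integrable_stretching hv hvB h1
  -- the remainder set and its functionals
  set R : Set E3 := (⋃ c ∈ F, Metric.ball c s)ᶜ with hR
  set ZR : ℝ := ∫ x in R, zd w x with hZR
  set WR : ℝ := ∫ x in R, wd w x with hWR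
  set JR : ℝ := ∫ x in R, sd w x with hJR
  have hZR0 : 0 ≤ ZR := setIntegral_nonneg (Finset.measurableSet_biUnion _ fun c _ => measurableSet_ball).compl fun x _ => sq_nonneg _
  have hWR0 : 0 ≤ WR := setIntegral_nonneg (Finset.measurableSet_biUnion _ fun c _ => measurableSet_ball).compl fun x _ => frobeniusNormSq_nonneg _
  -- exact partition of `Z`, `W`, `J`
  have hpartZ : (∑ c ∈ F, Zb w c s) + ZR = Zen w := by
    unfold Zen Zb; rw [hZR, hR]; exact (integral_eq_sum_balls_add_compl izd F hsep).symm
  have hpartW : (∑ c ∈ F, Wb w c s) + WR = Wpa w := by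
    unfold Wpa Wb; rw [hWR, hR]; exact (integral_eq_sum_balls_add_compl iwd F hsep).symm
  have hpartJ : (∑ c ∈ F, Jb w c s) + JR = Jst w := by
    unfold Jst Jb; rw [hJR, hR]; exact (integral_eq_sum_balls_add_compl isd F hsep).symm
  -- the pieces, indexed by `Option E3` (`none` = the remainder)
  set Zp : Option E3 → ℝ := fun o => o.elim ZR (fun c => Zb w c s) with hZp
  set Wp : Option E3 → ℝ := fun o => o.elim WR (fun c => Wb w c s) with hWp
  set Jraw : Option E3 → ℝ := fun o => o.elim JR (fun c => Jb w c s) with hJraw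
  set Jp : Option E3 → ℝ := fun o => min (Jraw o) (kStar * Real.sqrt (Zp o * Wp o)) with hJp
  set S : Finset (Option E3) := Finset.insertNone F with hS
  have hZp0 : ∀ o ∈ S, 0 ≤ Zp o := by
    intro o _; cases o with
    | none => exact hZR0
    | some c => exact Zb_nonneg _ _ _
  have hWp0 : ∀ o ∈ S, 0 ≤ Wp o := by
    intro o _; cases o with
    | none => exact hWR0
    | some c => exact Wb_nonneg _ _ _
  have hsharp : ∀ o ∈ S, Jp o ≤ kStar * Real.sqrt (Zp o * Wp o) := fun o _ => min_le_right _ _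
  have hsubZ : ∑ o ∈ S, Zp o ≤ Zen w := by
    rw [hS, Finset.sum_insertNone]; simp only [hZp, Option.elim]; linarith [hpartZ]
  have hsubW : ∑ o ∈ S, Wp o ≤ Wpa w := by
    rw [hS, Finset.sum_insertNone]; simp only [hWp, Option.elim]; linarith [hpartW]
  -- near-equality with the excess: `Σ Jp = J − Σ excess ≥ (κ⋆ − ε) Z − EX`
  have hsumJp : ∑ o ∈ S, Jp o = Jst w - ((∑ c ∈ F, max (Jb w c s - kStar * Real.sqrt (Zb w c s * Wb w c s)) 0) +
      max (JR - kStar * Real.sqrt (ZR * WR)) 0) := by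
    rw [hS, Finset.sum_insertNone]
    simp only [hJp, hJraw, hZp, hWp, Option.elim, min_eq_sub_posPart]
    rw [Finset.sum_sub_distrib, ← hpartJ]
    ring
  have hZZ : Real.sqrt (Zen w * Wpa w) = Zen w := by rw [hWZ]; exact Real.sqrt_mul_self hZ.le
  set ε' : ℝ := (ε * Zen w + EX) / (kStar * Zen w) with hε'
  have hnear : kStar * Real.sqrt (Zen w * Wpa w) * (1 - ε') ≤ ∑ o ∈ S, Jp o := by
    rw [hZZ, hsumJp]
    have hext' : (kStar - ε) * Zen w ≤ Jst w := by
      have : Real.sqrt (Zen w) * Real.sqrt (Wpa w) = Zen w := by rw [← Real.sqrt_mul hZ.le, hZZ]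
      calc (kStar - ε) * Zen w = (kStar - ε) * (Real.sqrt (Zen w) * Real.sqrt (Wpa w)) := by rw [this]
        _ = (kStar - ε) * Real.sqrt (Zen w) * Real.sqrt (Wpa w) := by ring
        _ ≤ Jst w := hext
    have e : kStar * Zen w * (1 - ε') = (kStar - ε) * Zen w - EX := by
      rw [hε']; field_simp; ring
    rw [e]
    linarith [hEX]
  -- typicality
  have htyp := typicality_abstract S Jp Zp Wp hκ hZ hW (L := 1) (by rw [one_mul, hWZ]) hδ hδ hδ1 hZp0 hWp0 hsharp hsubZ hsubW hnear
  -- the cells failing (i) or (ii) are `bad` pieces; the cells failing (iii) have `Zb < layer/δ`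
  have hlayer0 : ∀ c ∈ F, 0 ≤ (Zb w c (s + s ^ (7 / 8 : ℝ)) + Wb w c (s + s ^ (7 / 8 : ℝ))) - (Zb w c s + Wb w c s) := by
    intro c _
    have hsub : Metric.ball c s ⊆ Metric.ball c (s + s ^ (7 / 8 : ℝ)) :=
      Metric.ball_subset_ball (by linarith [Real.rpow_nonneg hs.le (7 / 8 : ℝ)])
    have h1 := Zb_mono hv hsub
    have h2 := Wb_mono hv hsub
    linarith
  -- bad pieces in the sense of `typicality_abstract`, restricted to the cells
  set badT : E3 → Prop := fun c => Jp (some c) < kStar * Real.sqrt (Zp (some c) * Wp (some c)) * (1 - δ) ∨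
      δ * Zp (some c) < |1 * Wp (some c) - Zp (some c)| with hbadT
  set heavy : E3 → Prop := fun c => δ * (Zb w c s + Wb w c s) <
      (Zb w c (s + s ^ (7 / 8 : ℝ)) + Wb w c (s + s ^ (7 / 8 : ℝ))) - (Zb w c s + Wb w c s) with hheavy
  -- (1) a cell that is not good is typicality-bad or has a heavy layer
  have hcover : F.filter (fun c => ¬ IsGoodBall w c s δ) ⊆ F.filter badT ∪ F.filter heavy := by
    intro c hc
    rw [Finset.mem_filter] at hc
    rw [Finset.mem_union, Finset.mem_filter, Finset.mem_filter]
    obtain ⟨hcF, hng⟩ := hc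
    unfold IsGoodBall at hng
    by_cases h1 : kStar * Real.sqrt (Zb w c s * Wb w c s) * (1 - δ) ≤ Jb w c s
    · by_cases h2 : |Wb w c s - Zb w c s| ≤ δ * Zb w c s
      · right
        refine ⟨hcF, ?_⟩
        show δ * (Zb w c s + Wb w c s) < _
        by_contra h3
        push Not at h3
        exact hng ⟨h1, h2, h3⟩
      · left
        refine ⟨hcF, Or.inr ?_⟩
        show δ * Zb w c s < |1 * Wb w c s - Zb w c s|
        rw [one_mul]; push Not at h2; exact h2
    · left
      refine ⟨hcF, Or.inl ?_⟩
      show min (Jb w c s) (kStar * Real.sqrt (Zb w c s * Wb w c s)) < kStar * Real.sqrt (Zb w c s * Wb w c s) * (1 - δ)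
      push Not at h1
      exact lt_of_le_of_lt (min_le_left _ _) h1
  have hnn : ∀ c ∈ F.filter badT ∪ F.filter heavy, 0 ≤ Zb w c s := fun c _ => Zb_nonneg _ _ _
  have hstep1 : ∑ c ∈ F.filter (fun c => ¬ IsGoodBall w c s δ), Zb w c s ≤
      (∑ c ∈ F.filter badT, Zb w c s) + ∑ c ∈ F.filter heavy, Zb w c s := by
    refine (Finset.sum_le_sum_of_subset_of_nonneg hcover (fun c hc _ => hnn c hc)).trans ?_
    rw [← Finset.sum_union_inter]
    have : 0 ≤ ∑ c ∈ F.filter badT ∩ F.filter heavy, Zb w c s := Finset.sum_nonneg fun c _ => Zb_nonneg _ _ _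
    linarith
  -- (2) the typicality-bad cells are bad pieces of `S`
  have hstep2 : ∑ c ∈ F.filter badT, Zb w c s ≤
      ∑ o ∈ S.filter (fun o => Jp o < kStar * Real.sqrt (Zp o * Wp o) * (1 - δ) ∨ δ * Zp o < |1 * Wp o - Zp o|), Zp o := by
    have e : ∑ c ∈ F.filter badT, Zb w c s = ∑ o ∈ (F.filter badT).map (Function.Embedding.some), Zp o := by
      rw [Finset.sum_map]; rfl
    rw [e]
    refine Finset.sum_le_sum_of_subset_of_nonneg ?_ (fun o ho _ => hZp0 o (Finset.mem_filter.1 ho).1)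
    intro o ho
    rw [Finset.mem_map] at ho
    obtain ⟨c, hc, rfl⟩ := ho
    rw [Finset.mem_filter] at hc ⊢
    exact ⟨by rw [hS]; exact Finset.some_mem_insertNone.2 hc.1, hc.2⟩
  -- (3) heavy-layer cells: `Zb ≤ layer/δ`
  have hstep3 : ∑ c ∈ F.filter heavy, Zb w c s ≤
      δ⁻¹ * ∑ c ∈ F, ((Zb w c (s + s ^ (7 / 8 : ℝ)) + Wb w c (s + s ^ (7 / 8 : ℝ))) - (Zb w c s + Wb w c s)) := by
    rw [Finset.mul_sum]
    refine (Finset.sum_le_sum (fun c hc => ?_)).trans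
      (Finset.sum_le_sum_of_subset_of_nonneg (Finset.filter_subset _ _) (fun c hc _ => mul_nonneg (inv_nonneg.2 hδ.le) (hlayer0 c hc)))
    · have hh : δ * (Zb w c s + Wb w c s) < (Zb w c (s + s ^ (7 / 8 : ℝ)) + Wb w c (s + s ^ (7 / 8 : ℝ))) - (Zb w c s + Wb w c s) :=
        (Finset.mem_filter.1 hc).2
      have hWb := Wb_nonneg w c s
      rw [← div_eq_inv_mul, le_div_iff₀ hδ]
      nlinarith
  -- (4) assemble
  have hε'eq : ε' * (18 / δ ^ 2 + 2 / δ) * Zen w = (ε / kStar + EX / (kStar * Zen w)) * (18 / δ ^ 2 + 2 / δ) * Zen w := by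
    rw [hε']; field_simp
  calc ∑ c ∈ F.filter (fun c => ¬ IsGoodBall w c s δ), Zb w c s
      ≤ (∑ c ∈ F.filter badT, Zb w c s) + ∑ c ∈ F.filter heavy, Zb w c s := hstep1
    _ ≤ ε' * (18 / δ ^ 2 + 2 / δ) * Zen w +
        δ⁻¹ * ∑ c ∈ F, ((Zb w c (s + s ^ (7 / 8 : ℝ)) + Wb w c (s + s ^ (7 / 8 : ℝ))) - (Zb w c s + Wb w c s)) :=
        add_le_add (hstep2.trans htyp) hstep3
    _ = _ := by rw [hε'eq]

end Summit.NavierStokesRegularity.NavierStokesRegularity.Theorems.NearExtremalTransiencePerFlow.TwoThirds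

end
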